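import Summits.Ventures.HodgeRepro2.T5HyperbolicCharacters

/-!
# T5HyperbolicQuotient — «U/SU ≅ E¹ by det»: the abelianisation of U(ℍ) (Tier-5 support, p3)

Kernel witness behind ONE line already on the record: route/T5-route-3.md v0.31 §F.1, «A character
of U(W) (W split, n ≥ 2; U/SU ≅ E¹ by det and SU = [U,U]) is ν′∘det for a character ν′ of E¹» — the
two isomorphisms behind the sentence, on top of `T5HyperbolicDet` (det : U(ℍ) →* E¹ onto) and
`T5HyperbolicCharacters` (SU(ℍ) = ker det = [U(ℍ), U(ℍ)]).

* `quotientKerDetEquiv` — `U(ℍ) ⧸ ker det ≃* E¹` («U/SU ≅ E¹ by det»), sending `[g]` to `det g`;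
* `abelianizationEquivNormOne` — `Abelianization U(ℍ) ≃* E¹` («U/[U,U] ≅ E¹»), sending `of g` to
  `det g` (`abelianizationEquivNormOne_of`);
* `exists_factor_det'` — the factorisation theorem re-read through the abelianisation: a character
  of U(ℍ) is `ν ∘ det` with `ν = (Abelianization.lift φ) ∘ (abelianizationEquivNormOne).symm`.

README §8(d): this file uses an L-value-free non-vanishing device: NO.
-/

namespace Summit.Ventures.HodgeRepro2.T5HyperbolicQuotient

open T5UnipotentCommutator ShimuraData.B3Characters T5NormOneCharacters T5HyperbolicDet
  T5HyperbolicCharacters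

variable {E : Type*} [Field E] [StarRing E]

/-- «U/SU ≅ E¹ by det»: `U(ℍ) ⧸ ker det ≃* E¹` (the involution non-trivial, so that `det` is onto). -/
noncomputable def quotientKerDetEquiv (hne : ∃ a : E, star a ≠ a) :
    hypUnitary E ⧸ (detNormOne : hypUnitary E →* _).ker ≃*
      normOne (unitsConj (starRingAut : E ≃+* E)) :=
  QuotientGroup.quotientKerEquivOfSurjective detNormOne (detNormOne_surjective hne)

/-- The isomorphism sends the class of `g` to `det g`. -/
theorem quotientKerDetEquiv_mk (hne : ∃ a : E, star a ≠ a) (g : hypUnitary E) :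
    quotientKerDetEquiv hne (QuotientGroup.mk g) = detNormOne g := rfl

/-- «U/[U,U] ≅ E¹»: the abelianisation of U(ℍ) is E¹ through `det` (given one norm ≠ 1, so that
`[U,U] = ker det`). -/
noncomputable def abelianizationEquivNormOne (hne : ∃ a : E, star a ≠ a)
    (hn : ∃ t : E, t ≠ 0 ∧ t * star t ≠ 1) :
    Abelianization (hypUnitary E) ≃* normOne (unitsConj (starRingAut : E ≃+* E)) :=
  (QuotientGroup.quotientMulEquivOfEq (commutator_eq_ker_det hne hn)).trans
    (quotientKerDetEquiv hne)

/-- The abelianisation isomorphism sends `Abelianization.of g` to `det g`. -/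
theorem abelianizationEquivNormOne_of (hne : ∃ a : E, star a ≠ a)
    (hn : ∃ t : E, t ≠ 0 ∧ t * star t ≠ 1) (g : hypUnitary E) :
    abelianizationEquivNormOne hne hn (Abelianization.of g) = detNormOne g := rfl

variable {M : Type*} [CommGroup M]

/-- The factorisation theorem read through the abelianisation: `φ = ν ∘ det` with
`ν := (Abelianization.lift φ) ∘ (abelianizationEquivNormOne).symm`. -/
theorem exists_factor_det' (hne : ∃ a : E, star a ≠ a) (hn : ∃ t : E, t ≠ 0 ∧ t * star t ≠ 1)
    (φ : hypUnitary E →* M) (g : hypUnitary E) :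
    φ g = ((Abelianization.lift φ).comp (abelianizationEquivNormOne hne hn).symm.toMonoidHom)
      (detNormOne g) := by
  rw [MonoidHom.comp_apply, MulEquiv.coe_toMonoidHom, ← abelianizationEquivNormOne_of hne hn g,
    MulEquiv.symm_apply_apply]
  rfl

end Summit.Ventures.HodgeRepro2.T5HyperbolicQuotient
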